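import Mathlib
import Summits.ValiantsHypothesis.ValiantsHypothesis.Theorems.KPlusLogSqLawWeakLiftingTowerGraftSpikePotential

/-!
# Tower graft line — EVENT LOCALISATION: a zero of the log-slope potential sits within `2n/D` of an in-sector root

Mechanism file for the line `Cruxes/WeakLifting/Lines/tower_graft.lean` (crux `WeakLifting` = stmt-ValiantsHypothesis-19561,
memo `tower_graft-S5.md` §3 T1); the kernel-grade step (a) of the general T1 argument of
`HOME/val-sym-lift-p1/g20/memo/T1-CORNER-liftp1g20.md` §5 (the rest of which — Rouché on cluster hulls — is paper for now).
NO stub is claimed.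

THE LEMMA (`exists_inSector_root_near_of_residual_zero`).  `A, E ∈ ℝ[X]` non-zero, `0 < s ≤ 1`, `4·(deg A + deg E) ≤ s·D`, `t > 0` with
`A(t)E(t) ≠ 0`.  If the Rolle–Schur residual `W = X(A′E − AE′) − D·AE` of the graft `A + X^D·E` vanishes at `t` (equivalently the
log-slope potential `Φ(t) = t·A′/A − D − t·E′/E` vanishes), then SOME complex root `z` of `A·E` is IN-SECTOR (`¬ (s‖z‖ ≤ |Im z| ∨ Re z ≤ 0)`)
and CLOSE: `‖t − z‖ ≤ (2(deg A + deg E)/D)·t`.  No hypothesis on where the roots are: the off-sector roots contribute at most `n/s ≤ D/4`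
to `|Φ + D| = D`, so the in-sector ones contribute `≥ 3D/4`, one of them at least `3D/(4n)` — and an off-sector root never could
(`‖t − z‖ ≥ s·t`).  With `…RealEvents` (one-sided real events) this is the part of T1 that is kernel today; the hull/Rouché count of memo §5
is what turns «every crossing sits near an event» into «≤ 2 crossings per event».

HONEST FRAMING: elementary; nothing on S4/S4b/S5, TowerB, `WeakLifting`, Conjecture B, `MatrixDescartes` (18050) or `VP ≠ VNP`.  Def-free.
Seat: prover val-sym-lift-p1 g20, `--supports stmt-ValiantsHypothesis-19561`.
-/

-- `Summit.ValiantsHypothesis.ValiantsHypothesis.…` repeats a component by the D-0017 layout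
-- (single-conjunct summit), which the `dupNamespace` linter flags; the name is mandated.
set_option linter.dupNamespace false

namespace Summit.ValiantsHypothesis.ValiantsHypothesis.Theorems.KPlusLogSqLaw.TowerGraft

open Polynomial
open scoped BigOperators Polynomial

section Localisation

/-- the modulus of a root sum is at most the sum of the moduli of its terms (real part version). [folklore] -/
theorem abs_rootSum_re_le_sum_norm (m : Multiset ℂ) (t : ℝ) :
    |((m.map fun z => (t : ℂ) / ((t : ℂ) - z)).sum).re| ≤ (m.map fun z => ‖(t : ℂ) / ((t : ℂ) - z)‖).sum := by
  calc |((m.map fun z => (t : ℂ) / ((t : ℂ) - z)).sum).re|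
      ≤ ‖(m.map fun z => (t : ℂ) / ((t : ℂ) - z)).sum‖ := Complex.abs_re_le_norm _
    _ ≤ ((m.map fun z => (t : ℂ) / ((t : ℂ) - z)).map fun x => ‖x‖).sum := norm_multiset_sum_le _
    _ = (m.map fun z => ‖(t : ℂ) / ((t : ℂ) - z)‖).sum := by rw [Multiset.map_map]; rfl

/-- **EVENT LOCALISATION.**  If the residual `X(A′E − AE′) − D·AE` vanishes at `t > 0` off the roots of `A·E`, with `D > 0` and
`4(deg A + deg E) ≤ s·D`, then some complex root of `A·E` is in-sector and within `(2(deg A + deg E)/D)·t` of `t`. [this work] -/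
theorem exists_inSector_root_near_of_residual_zero {s : ℝ} (hs : 0 < s) (hs1 : s ≤ 1) (A E : ℝ[X]) {D : ℕ} (hD : 0 < D)
    (hdeg : 4 * ((A.natDegree : ℝ) + E.natDegree) ≤ s * D)
    {t : ℝ} (ht : 0 < t) (hAt : A.eval t ≠ 0) (hEt : E.eval t ≠ 0)
    (hW : (X * (derivative A * E - A * derivative E) - C (D : ℝ) * (A * E)).eval t = 0) :
    ∃ z ∈ (A.map Complex.ofRealHom).roots + (E.map Complex.ofRealHom).roots,
      ¬ (s * ‖z‖ ≤ |z.im| ∨ z.re ≤ 0) ∧ ‖(t : ℂ) - z‖ ≤ 2 * (((A.natDegree : ℝ) + E.natDegree) / D) * t := by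
  classical
  set n : ℝ := (A.natDegree : ℝ) + E.natDegree with hn
  set Z := (A.map Complex.ofRealHom).roots + (E.map Complex.ofRealHom).roots with hZ
  -- the potential vanishes
  have hΦ : t * (A.derivative.eval t / A.eval t) - D - t * (E.derivative.eval t / E.eval t) = 0 := by
    have h0 := residual_eval_eq A E D hAt hEt
    rw [hW] at h0
    rcases mul_eq_zero.mp h0.symm with h1 | h1
    · exact absurd h1 (mul_ne_zero hAt hEt)
    · exact h1
  rw [mul_logDeriv_eq_rootSum_re A hAt, mul_logDeriv_eq_rootSum_re E hEt] at hΦ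
  -- cardinalities
  have hcardA : (Multiset.card (A.map Complex.ofRealHom).roots : ℝ) = A.natDegree := by
    rw [← (IsAlgClosed.splits (A.map Complex.ofRealHom)).natDegree_eq_card_roots,
      Polynomial.natDegree_map_eq_of_injective Complex.ofRealHom.injective]
  have hcardE : (Multiset.card (E.map Complex.ofRealHom).roots : ℝ) = E.natDegree := by
    rw [← (IsAlgClosed.splits (E.map Complex.ofRealHom)).natDegree_eq_card_roots,
      Polynomial.natDegree_map_eq_of_injective Complex.ofRealHom.injective]
  have hcardZ : (Multiset.card Z : ℝ) = n := by
    rw [hZ, Multiset.card_add, Nat.cast_add, hcardA, hcardE]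
  have hD0 : (0 : ℝ) < D := by exact_mod_cast hD
  have hD4 : n / s ≤ D / 4 := by rw [div_le_iff₀ hs]; linarith
  -- `D ≤ Σ_Z ‖t/(t−z)‖`
  have hDle : (D : ℝ) ≤ (Z.map fun z => ‖(t : ℂ) / ((t : ℂ) - z)‖).sum := by
    have h1 := abs_rootSum_re_le_sum_norm (A.map Complex.ofRealHom).roots t
    have h2 := abs_rootSum_re_le_sum_norm (E.map Complex.ofRealHom).roots t
    have e1 := le_abs_self ((((A.map Complex.ofRealHom).roots.map fun z => (t : ℂ) / ((t : ℂ) - z)).sum).re)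
    have e2 := neg_abs_le ((((E.map Complex.ofRealHom).roots.map fun z => (t : ℂ) / ((t : ℂ) - z)).sum).re)
    rw [hZ, Multiset.map_add, Multiset.sum_add]
    linarith
  set f : ℂ → ℝ := fun z => ‖(t : ℂ) / ((t : ℂ) - z)‖ with hf
  -- split `Z` into off-sector and in-sector roots
  set OFF := Z.filter (fun z => s * ‖z‖ ≤ |z.im| ∨ z.re ≤ 0) with hOFF
  set IN := Z.filter (fun z => ¬ (s * ‖z‖ ≤ |z.im| ∨ z.re ≤ 0)) with hIN
  have hsplit : (Z.map f).sum = (OFF.map f).sum + (IN.map f).sum := by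
    rw [← Multiset.sum_add, ← Multiset.map_add, Multiset.filter_add_not]
  have hOFFle : (OFF.map f).sum ≤ n / s := by
    calc (OFF.map f).sum ≤ (OFF.map fun _ => 1 / s).sum :=
          Multiset.sum_map_le_sum_map _ _ fun z hz =>
            norm_div_sub_le_of_offSector hs hs1 ht (Multiset.mem_filter.mp hz).2
      _ = Multiset.card OFF / s := by
          rw [Multiset.map_const', Multiset.sum_replicate, nsmul_eq_mul, ← div_eq_mul_one_div]
      _ ≤ n / s := by
          refine div_le_div_of_nonneg_right ?_ hs.le
          rw [← hcardZ]; exact_mod_cast Multiset.card_le_card (Multiset.filter_le _ Z)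
  have hINge : 3 * D / 4 ≤ (IN.map f).sum := by linarith
  have hcardIN : (Multiset.card IN : ℝ) ≤ n := by
    rw [← hcardZ]; exact_mod_cast Multiset.card_le_card (Multiset.filter_le _ Z)
  have hINne : IN ≠ 0 := by
    intro h0
    rw [h0, Multiset.map_zero, Multiset.sum_zero] at hINge
    linarith
  have hn1 : 1 ≤ n := by
    have h1 : 0 < Multiset.card IN := Multiset.card_pos.mpr hINne
    have h2 : (1 : ℝ) ≤ Multiset.card IN := by exact_mod_cast h1
    linarith
  -- pigeonhole: some in-sector term is at least `D/(2n)`, i.e. some in-sector root is `2(n/D)·t`-close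
  by_contra hno
  push Not at hno
  have hc : 0 < 2 * (n / D) * t := by positivity
  have hlt : ∀ z ∈ IN, f z < D / (2 * n) := by
    intro z hz
    obtain ⟨hzZ, hzin⟩ := Multiset.mem_filter.mp hz
    have hzin' : |z.im| < s * ‖z‖ ∧ 0 < z.re :=
      ⟨not_le.mp fun h => hzin (Or.inl h), not_le.mp fun h => hzin (Or.inr h)⟩
    have hfar := hno z hzZ hzin'
    have hfz : f z = t / ‖(t : ℂ) - z‖ := by
      rw [hf]
      simp only []
      rw [norm_div, Complex.norm_real, Real.norm_eq_abs, abs_of_pos ht]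
    rw [hfz]
    calc t / ‖(t : ℂ) - z‖ < t / (2 * (n / D) * t) := div_lt_div_of_pos_left ht hc hfar
      _ = D / (2 * n) := by field_simp
  have hsum_lt : (IN.map f).sum < (IN.map fun _ => (D : ℝ) / (2 * n)).sum :=
    Multiset.sum_lt_sum_of_nonempty hINne hlt
  have hconst : (IN.map fun _ => (D : ℝ) / (2 * n)).sum ≤ D / 2 := by
    rw [Multiset.map_const', Multiset.sum_replicate, nsmul_eq_mul]
    calc (Multiset.card IN : ℝ) * (D / (2 * n)) ≤ n * (D / (2 * n)) :=
          mul_le_mul_of_nonneg_right hcardIN (by positivity)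
      _ = D / 2 := by field_simp
  linarith

end Localisation

end Summit.ValiantsHypothesis.ValiantsHypothesis.Theorems.KPlusLogSqLaw.TowerGraft
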